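import Summits.ResolutionOfSingularities.ResolutionOfSingularities.Theorems.EquisingularLiftEquisingularLiftNatDirectionRoundChart
import Summits.ResolutionOfSingularities.ResolutionOfSingularities.Theorems.EquisingularLiftEquisingularLiftNatConormalFrameOfGenerators
import Summits.ResolutionOfSingularities.ResolutionOfSingularities.Theorems.EquisingularLiftEquisingularLiftNatDirZeroDefs
import HarnessLib

/-!
# Route `EquisingularLift`, crux EL♮(3) (stmt-ResolutionOfSingularities-20148) — C2 sub-brick B1b: the conormal frame `[T̄]` of the section
# `Γ̃₁ ⊂ Ẽ₁` on the chart of the round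

res-rescue-typ-5 g3 as a w45b pool hand, on res-type-027 g15's signature `L/res-type-027/B1b-ConormalFrameChart.sig.lean` (sha16 e44fdc813f18078a)
VERBATIM (desk res-L1-w45b-plan-1 g18 00:04:10Z «B1b → res-rescue-typ-5 on sig»). OURS; NOT a statement of any manuscript; AI-written, weaker than
expert review. No `sorry`; standard axioms; DEF-FREE; `--supports stmt-ResolutionOfSingularities-20148 --as helper`.

INPUTS: B1a (res-type-027 p587502 `…NatDirectionRoundChart`: on the chart `V := G₁[W, c₁]`, `(Ī.comap υ₁)(V) = (g)` with `g := υ₁^*c₁` a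
nonzerodivisor — `ideal_comap_blowupChart_eq_span`; `σᶜ(𝒟',1)(V) = (T) + (g)` — `ideal_controlledTransform_direction_chart`; `T·a ∈ (g) ⇒ a ∈ (g)` —
`mem_span_of_chartRatio_mul_mem_span`) and this seat's engine `exists_conormalFrame_of_generator` (p586543).

PROOF (027's recipe). `Ẽ₁ := redSub G₁ E₁`, `ι_E := redSubι G₁ E₁ hE₁` (a closed immersion, so `Ẽ₁` is locally Noetherian and `i₁` is a closed immersion by
`hi₁`), `V_E := ι_E⁻¹ V` (affine). Every section of `Ẽ₁` over `V_E` lifts to `Γ(G₁, V)` (`subschemeι_app_surjective`) with kernel `𝓘⟨E₁⟩(V) =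
(Ī.comap υ₁)(V) = (g)` (`ker_subschemeι_app`, `hEĪ`, B1a); hence (1) `T̄ := T|_{Ẽ₁}` is a NONZERODIVISOR (`T̄·ā = 0 ⇒ T·a ∈ (g) ⇒ a ∈ (g) ⇒ ā = 0`), and
(2) `ker(i₁♯)(V_E) = (T̄)`: through `hi₁`, `i₁♯(t̄) = 0 ⟺ ι_Γ♯(t) = 0 ⟺ t ∈ 𝓘⟨Γ₁⟩(V) = σᶜ(𝒟',1)(V) = (T) + (g)` (`hctr`, B1a), whose image in
`Γ(Ẽ₁, V_E)` is `(T̄)`. The engine at `n = 1` then frames `i₁^*𝓘` on every `B ≤ i₁⁻¹V_E` by `η(s)|_B`, `s ↦ T̄`.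
-/

noncomputable section

-- `TopCat.Presheaf`/`Scheme.Modules` are not reducible (as in Mathlib's `AlgebraicGeometry/Modules`).
set_option backward.isDefEq.respectTransparency false

open CategoryTheory CategoryTheory.Limits AlgebraicGeometry TopologicalSpace Opposite
open Literature.AlgebraicGeometry.Resolution Literature.AlgebraicGeometry.Deformation Literature.AlgebraicGeometry.Modules
open Literature.AlgebraicGeometry.Motives Literature.AlgebraicGeometry.HodgeTheory
open AlgebraicGeometry.Scheme.IdealSheafData

set_option linter.dupNamespace false -- mandated namespace `Summit.<Summit>.<Problem>` of this single-conjunct summit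

namespace Summit.ResolutionOfSingularities.ResolutionOfSingularities.Cruxes.EquisingularLiftNat.Sections

/-! ## Plumbing for the reduced structures -/

/-- A factorisation `i ≫ ι_E = ι_Γ` of one reduced closed subscheme through another is a closed immersion. [folklore] -/
theorem isClosedImmersion_of_comp_redSubι {G : Scheme.{0}} (E : Set G) (hE : IsClosed E) (Γ : Set G) (hΓ : IsClosed Γ)
    (i : redSub G Γ hΓ ⟶ redSub G E hE) (hi : i ≫ redSubι G E hE = redSubι G Γ hΓ) : IsClosedImmersion i := by
  haveI : IsClosedImmersion (i ≫ redSubι G E hE) := by rw [hi]; infer_instance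
  exact IsClosedImmersion.of_comp_isClosedImmersion i (redSubι G E hE)

/-- Through `i ≫ ι_E = ι_Γ`: `i♯(ι_E♯ t) = 0 ↔ ι_Γ♯ t = 0` on any open of `G`. [folklore] -/
theorem app_app_eq_zero_iff_of_comp_redSubι {G : Scheme.{0}} (E : Set G) (hE : IsClosed E) (Γ : Set G) (hΓ : IsClosed Γ)
    (i : redSub G Γ hΓ ⟶ redSub G E hE) (hi : i ≫ redSubι G E hE = redSubι G Γ hΓ) (V : G.Opens) (t : Γ(G, V)) :
    i.app ((redSubι G E hE) ⁻¹ᵁ V) ((redSubι G E hE).app V t) = 0 ↔ (redSubι G Γ hΓ).app V t = 0 := by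
  have h1 : i.app ((redSubι G E hE) ⁻¹ᵁ V) ((redSubι G E hE).app V t) = (i ≫ redSubι G E hE).app V t := rfl
  rw [h1]
  constructor
  · intro h
    rw [Scheme.Hom.congr_app hi.symm V, CommRingCat.comp_apply, h, map_zero]
  · intro h
    rw [Scheme.Hom.congr_app hi V, CommRingCat.comp_apply, h, map_zero]

/-! ## The brick -/

/-- **B1b** — conormal frame of the section on the chart of the round (res-type-027's `B1b-ConormalFrameChart.sig.lean` e44fdc813f18078a
VERBATIM): with the adapted frame `(W, c)` (B1′) and the chart ratio `T` (`g·T = υ₁^*c₀`), the conormal LINE bundle `𝒞_{Γ̃₁/Ẽ₁} = i₁^*𝓘` is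
framed on every open `B ⊆ Γ̃₁` over the chart `G₁[W, c₁]` by the unit section `η(s)|_B` of an ideal-module section `s` of `𝓘 = ker(i₁♯)` over
`Ẽ₁ ∩ G₁[W, c₁]` reading to `T̄ = T|_{Ẽ₁}`. [OURS · L1 W4.5b (L) C2/B1b] -/
theorem exists_conormalFrame_direction_chart {G₁ G₀ : Scheme.{0}} [IsLocallyNoetherian G₀] [IsLocallyNoetherian G₁]
    {υ₁ : G₁ ⟶ G₀} {Ī : G₀.IdealSheafData} (hυ₁ : IsBlowup υ₁ Ī) (𝒟' : G₀.IdealSheafData)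
    (E₁ : Set G₁) (hE₁ : IsClosed E₁) (Γ₁ : Set G₁) (hΓ₁ : IsClosed Γ₁)
    (hEĪ : vanishingIdeal (⟨E₁, hE₁⟩ : Closeds G₁) = Ī.comap υ₁)
    (hctr : controlledTransform υ₁ Ī 𝒟' 1 = vanishingIdeal (⟨Γ₁, hΓ₁⟩ : Closeds G₁))
    (i₁ : redSub G₁ Γ₁ hΓ₁ ⟶ redSub G₁ E₁ hE₁) (hi₁ : i₁ ≫ redSubι G₁ E₁ hE₁ = redSubι G₁ Γ₁ hΓ₁)
    (W : G₀.affineOpens) (c : Fin 2 → Γ(G₀, (W : G₀.Opens))) (hc : Ideal.span (Set.range c) = Ī.ideal W) (hqr : IsQuasiRegular c)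
    (h𝒟 : 𝒟'.ideal W = Ideal.span {c 0} ⊔ (Ī.ideal W) ^ 2)
    (T : Γ(G₁, blowupChart υ₁ Ī W (c 1)))
    (hT : υ₁.appLE W (blowupChart υ₁ Ī W (c 1)) (blowupChart_le_preimage υ₁ Ī W (c 1)) (c 1) * T =
      υ₁.appLE W (blowupChart υ₁ Ī W (c 1)) (blowupChart_le_preimage υ₁ Ī W (c 1)) (c 0))
    {B : (redSub G₁ Γ₁ hΓ₁).Opens} (hB : B ≤ i₁ ⁻¹ᵁ ((redSubι G₁ E₁ hE₁) ⁻¹ᵁ blowupChart υ₁ Ī W (c 1))) :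
    ∃ (s : Γ(idealModule i₁, (redSubι G₁ E₁ hE₁) ⁻¹ᵁ blowupChart υ₁ Ī W (c 1)))
      (κ : SheafOfModules.free (Fin 1) ≅ (conormalSheaf i₁).over B),
      toRing (idealModuleι i₁) ((redSubι G₁ E₁ hE₁) ⁻¹ᵁ blowupChart υ₁ Ī W (c 1)) s =
          (redSubι G₁ E₁ hE₁).appLE (blowupChart υ₁ Ī W (c 1)) ((redSubι G₁ E₁ hE₁) ⁻¹ᵁ blowupChart υ₁ Ī W (c 1)) le_rfl T ∧
        basisSection κ 0 = unitSectionLE i₁ (idealModule i₁) hB s := by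
  classical
  -- notation-free abbreviations
  have hc0 : c 0 ∈ Ī.ideal W := mem_ideal_of_span_range_eq W c hc 0
  have hc1 : c 1 ∈ Ī.ideal W := mem_ideal_of_span_range_eq W c hc 1
  let V : G₁.affineOpens := ⟨blowupChart υ₁ Ī W (c 1), hυ₁.isAffineOpen_blowupChart hc1⟩
  let ιE := redSubι G₁ E₁ hE₁
  let ιΓ := redSubι G₁ Γ₁ hΓ₁
  haveI : IsClosedImmersion i₁ := isClosedImmersion_of_comp_redSubι E₁ hE₁ Γ₁ hΓ₁ i₁ hi₁
  haveI : IsLocallyNoetherian (redSub G₁ E₁ hE₁) := LocallyOfFiniteType.isLocallyNoetherian (redSubι G₁ E₁ hE₁)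
  let VE : (redSub G₁ E₁ hE₁).affineOpens := ⟨(redSubι G₁ E₁ hE₁) ⁻¹ᵁ blowupChart υ₁ Ī W (c 1), V.2.preimage (redSubι G₁ E₁ hE₁)⟩
  -- B1a on the chart
  obtain ⟨hĪV, hgnzd⟩ := ideal_comap_blowupChart_eq_span hυ₁ W c hc1
  have hΓV : (vanishingIdeal (⟨Γ₁, hΓ₁⟩ : Closeds G₁)).ideal V =
      Ideal.span {T} ⊔ Ideal.span {υ₁.appLE W (blowupChart υ₁ Ī W (c 1)) (blowupChart_le_preimage υ₁ Ī W (c 1)) (c 1)} := by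
    rw [← hctr]; exact ideal_controlledTransform_direction_chart hυ₁ 𝒟' W c hc1 h𝒟 T hT
  have hEV : (vanishingIdeal (⟨E₁, hE₁⟩ : Closeds G₁)).ideal V =
      Ideal.span {υ₁.appLE W (blowupChart υ₁ Ī W (c 1)) (blowupChart_le_preimage υ₁ Ī W (c 1)) (c 1)} := by
    rw [hEĪ]; exact hĪV
  -- sections of `Ẽ₁` over `V_E`: lifts and kernel
  have hker : ∀ t : Γ(G₁, blowupChart υ₁ Ī W (c 1)), (redSubι G₁ E₁ hE₁).app (blowupChart υ₁ Ī W (c 1)) t = 0 ↔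
      t ∈ Ideal.span {υ₁.appLE W (blowupChart υ₁ Ī W (c 1)) (blowupChart_le_preimage υ₁ Ī W (c 1)) (c 1)} := by
    intro t
    rw [← hEV, ← ker_subschemeι_app _ V, RingHom.mem_ker]
  have hg0 : (redSubι G₁ E₁ hE₁).app (blowupChart υ₁ Ī W (c 1))
      (υ₁.appLE W (blowupChart υ₁ Ī W (c 1)) (blowupChart_le_preimage υ₁ Ī W (c 1)) (c 1)) = 0 :=
    (hker _).mpr (Ideal.mem_span_singleton_self _)
  have hsurj := (vanishingIdeal (⟨E₁, hE₁⟩ : Closeds G₁)).subschemeι_app_surjective V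
  -- `T̄`
  have hTb : (redSubι G₁ E₁ hE₁).appLE (blowupChart υ₁ Ī W (c 1)) ((redSubι G₁ E₁ hE₁) ⁻¹ᵁ blowupChart υ₁ Ī W (c 1)) le_rfl T =
      (redSubι G₁ E₁ hE₁).app (blowupChart υ₁ Ī W (c 1)) T := by
    rw [Scheme.Hom.app_eq_appLE]
  -- (1) `T̄` is a nonzerodivisor
  have hnzd : (redSubι G₁ E₁ hE₁).app (blowupChart υ₁ Ī W (c 1)) T ∈ nonZeroDivisors Γ(redSub G₁ E₁ hE₁, (VE : (redSub G₁ E₁ hE₁).Opens)) := by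
    refine (mem_nonZeroDivisors_iff_right).mpr fun ab hab => ?_
    obtain ⟨a, rfl⟩ := hsurj ab
    have h1 : (redSubι G₁ E₁ hE₁).app (blowupChart υ₁ Ī W (c 1)) (T * a) = 0 := by
      rw [map_mul, mul_comm]; exact hab
    obtain ⟨b, hb⟩ := Ideal.mem_span_singleton'.mp
      (mem_span_of_chartRatio_mul_mem_span hυ₁ W c hc hqr T hT a ((hker _).mp h1))
    rw [← hb, map_mul, hg0, mul_zero]
  -- (2) the kernel of `i₁♯` on `V_E` is `(T̄)`
  have hkerI : Ideal.span {(redSubι G₁ E₁ hE₁).app (blowupChart υ₁ Ī W (c 1)) T} = i₁.ker.ideal VE := by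
    rw [Scheme.Hom.ker_apply]
    apply le_antisymm
    · rw [Ideal.span_singleton_le_iff_mem, RingHom.mem_ker]
      change i₁.app ((redSubι G₁ E₁ hE₁) ⁻¹ᵁ blowupChart υ₁ Ī W (c 1)) ((redSubι G₁ E₁ hE₁).app (blowupChart υ₁ Ī W (c 1)) T) = 0
      rw [app_app_eq_zero_iff_of_comp_redSubι E₁ hE₁ Γ₁ hΓ₁ i₁ hi₁, ← RingHom.mem_ker, ker_subschemeι_app _ V, hΓV]
      exact Ideal.mem_sup_left (Ideal.mem_span_singleton_self _)
    · intro xb hxb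
      obtain ⟨x, rfl⟩ := hsurj xb
      have h1 : (redSubι G₁ Γ₁ hΓ₁).app (blowupChart υ₁ Ī W (c 1)) x = 0 :=
        (app_app_eq_zero_iff_of_comp_redSubι E₁ hE₁ Γ₁ hΓ₁ i₁ hi₁ _ x).mp (RingHom.mem_ker.mp hxb)
      have h2 : x ∈ (vanishingIdeal (⟨Γ₁, hΓ₁⟩ : Closeds G₁)).ideal V := by
        rw [← ker_subschemeι_app _ V, RingHom.mem_ker]; exact h1
      rw [hΓV, Ideal.mem_span_singleton_sup] at h2
      obtain ⟨a, b, hb, hx⟩ := h2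
      obtain ⟨b', rfl⟩ := Ideal.mem_span_singleton'.mp hb
      rw [← hx, map_add, map_mul, map_mul, hg0, mul_zero, add_zero]
      exact Ideal.mul_mem_left _ _ (Ideal.mem_span_singleton_self _)
  -- (3) the engine at `n = 1`
  obtain ⟨s, κ, hs, hκ⟩ := exists_conormalFrame_of_generator i₁ VE _ hnzd hkerI hB
  exact ⟨s, κ, hs.trans hTb.symm, hκ⟩

end Summit.ResolutionOfSingularities.ResolutionOfSingularities.Cruxes.EquisingularLiftNat.Sections

end
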